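import Summits.BirchSwinnertonDyer.BirchSwinnertonDyer.Theorems.GenusKolyvaginAtTwoGenusDeepSupplyAtTwoNegDiscNarrowKFourCellHalvingDescentKFourNeg
import Literature.NumberTheory.EllipticCurves.HeegnerModuleIndex
import Literature.NumberTheory.EllipticCurves.LocalUniversalNorms
import Literature.NumberTheory.EllipticCurves.PAdicLFunction
import HarnessLib

/-!
# Sketch — vertical first-layer supply (crux-ideate seat 2, lens `control`)

Typed statements only (no proofs beyond `decide` on the trace multipliers); crux
`GenusDeepSupplyAtTwoNegDiscNarrow` / kernel `K4Neg` (stmt-BirchSwinnertonDyer-31526).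

* `traceMult a k` : the multiplier `t_k` with `Tr_{K[2^k]/K} y(2^k) = t_k • y_K` for 2 split in `K`
  (Gross §3 `T₂`-relations: `t₀ = 1, t₁ = a−2, t₂ = a t₁ − t₀, t_{k+1} = a t_k − 2 t_{k−1}` (k ≥ 2)).
* `TraceMultTwoAdic` : `v₂(t_k) = 2c` for `k ≥ 2c+2`, `c = v₂(3 − a₂)` (FL-a, decidable pattern).
* `VerticalLocalDefectAtTwo` : (V-loc) the local universal-norm index of `E(ℚ₂)` in the
  anticyclotomic `ℤ₂`-tower at a prime above 2 divides `(3 − a₂)² = 2^{2c}` (Mazur 1972 §4).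
* `FirstLayerPrimitive` : (V-prim) `z₁ = Norm_{K[8]/K₁} P[8] ∉ 2 E(K₁)`, `K₁` the first layer.
* `HsharpOfFirstLayerPrimitive` : (V-prim) ⟹ the `hsharp` binder of gk2-p5's
  `kFourNeg_shape_of_two_pow_pred_smul_ne_zero` (a `2^M`-Selmer class over `ℚ` with
  `2^{M₀-1} • s₀ ≠ 0`) on the good-ordinary-at-2 sub-cell.
-/

namespace Summit.BirchSwinnertonDyer.BirchSwinnertonDyer.Cruxes.GenusDeepSupplyAtTwoNegDiscNarrow.VerticalFirstLayerSupply

open Literature.NumberTheory.EllipticCurves Literature.NumberTheory.EllipticCurves.ModularForms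
open WeierstrassCurve

/-- Trace multiplier `t_k`: `Tr_{K[2^k]/K} y(2^k) = t_k • y_K` (2 split in `K`, `a = a₂`). -/
def traceMult (a : ℤ) : ℕ → ℤ
  | 0 => 1
  | 1 => a - 2
  | 2 => a * (a - 2) - 1
  | (k + 3) => a * traceMult a (k + 2) - 2 * traceMult a (k + 1)

example : (List.range 11).map (traceMult 1) = [1, -1, -2, 0, 4, 4, -4, -12, -4, 20, 28] := by decide
example : (List.range 11).map (traceMult (-1)) = [1, -3, 2, 4, -8, 0, 16, -16, -16, 48, -16] := by
  decide

/-- (FL-a) the 2-adic pattern of the trace multipliers for good ordinary reduction at 2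
(`a₂ = ±1`): `t_k ≡ 4 (mod 8)` for `a₂ = 1, k ≥ 4`; `t_k ≡ 16 (mod 32)` for `a₂ = −1, k ≥ 6`;
i.e. `v₂(t_k) = 2c`, `c = v₂(3 − a₂) = v₂(#Ẽ(𝔽₂))`. -/
def TraceMultTwoAdic : Prop :=
  (∀ k : ℕ, 4 ≤ k → traceMult 1 k % 8 = 4) ∧ (∀ k : ℕ, 6 ≤ k → traceMult (-1) k % 32 = 16)

/-- (V-loc) local universal-norm defect at a prime `w ∣ 2` of `K` (2 split, `K_w = ℚ₂`) in the
anticyclotomic `ℤ₂`-tower, good ordinary reduction at 2: the index `[E(K_w) : N_∞]` divides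
`(3 − a₂)² = #Ẽ(𝔽₂)² = 2^{2c}` (Mazur 1972 §4 (4.33), (4.39)–(4.40); Jones 1991 Prop. 2.1;
Lubin–Rosen 1978). By Herbrand quotient 1 this bounds `#H¹(K_{m,𝔓}/ℚ₂, E(K_{m,𝔓})) ≤ 2^{2c}`. -/
def VerticalLocalDefectAtTwo : Prop :=
  ∀ (W : WeierstrassCurve ℚ) [W.IsElliptic] [W.IsGloballyMinimal], IsOrdinaryAt W 2 →
  ∀ (K : Type) [Field K] [NumberField K], IsImaginaryQuadratic K →
    ((Ideal.span {(2 : ℤ)}).primesOver (NumberField.RingOfIntegers K)).ncard = 2 →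
  ∀ (κ : ZpExtension K 2), κ.IsAnticyclotomic →
  ∀ (w : IsDedekindDomain.HeightOneSpectrum (NumberField.RingOfIntegers K)),
    (2 : NumberField.RingOfIntegers K) ∈ w.asIdeal →
    localUniversalNormIndex (W := W.baseChange K) (w.adicCompletion K) κ ⊤ ∣
      Int.natAbs (3 - W.frobeniusTrace 2) ^ 2

/-- (V-prim) FIRST-LAYER PRIMITIVITY: every norm `z₁ = Norm_{K[8]/K₁} P[8]` of a Heegner point of
conductor 8 to the first anticyclotomic layer `K₁ = K(√2)` is not 2-divisible in `E(K₁)`. -/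
def FirstLayerPrimitive (W : WeierstrassCurve ℚ) [W.IsElliptic] [NeZero (W.conductorNorm ℤ)]
    (K : Type) [Field K] [NumberField K] (κ : ZpExtension K 2)
    (Dt : ModularParametrizationData W (W.conductorNorm ℤ)) (β : ℤ)
    (jbar : AlgebraicClosure K →+* ℂ) : Prop :=
  ∀ z : geomPoints (W.baseChange K),
    IsHeegnerNormPoint (W.conductorNorm ℤ) W K κ Dt β jbar 1 8 z →
    ¬ ∃ Q : geomPoints (W.baseChange K),
        (∀ τ ∈ κ.layerSubgroup 1, τ • Q = Q) ∧ (2 : ℤ) • Q = z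

/-- THE LINE: on the good-ordinary-at-2 sub-cell of the `K4Neg` cell (prime frame dropped — only
2 split is used), first-layer primitivity (V-prim) supplies the `hsharp` binder of
`kFourNeg_shape_of_two_pow_pred_smul_ne_zero`: a `2^M`-Selmer class `s₀` over `ℚ` with
`2^{M₀-1} • s₀ ≠ 0` (`M = M₀ + 2c`, `s₀ = 2^{2c} •` the vertical derivative class). -/
def HsharpOfFirstLayerPrimitive : Prop :=
  ∀ (W : WeierstrassCurve ℚ) [W.IsElliptic] [W.IsGloballyMinimal] [NeZero (W.conductorNorm ℤ)],
    ¬ W.HasCM → W.analyticRank = 0 →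
    (∀ n : ℕ, 0 < n → W.HasSurjectiveModNGaloisRep ((2 : ℤ) ^ n)) →
    Odd W.tamagawaProduct → W.Δ < 0 → IsOrdinaryAt W 2 →
  ∀ (K : Type) [Field K] [NumberField K], IsImaginaryQuadratic K →
    SatisfiesHeegnerHypothesis (W.conductorNorm ℤ) K →
    ¬ IsSquare ((NumberField.discr K : ℚ) * -|W.Δ|) →
    ¬ IsSquare ((NumberField.discr K : ℚ) * (-(2 * |W.Δ|))) →
    ((Ideal.span {(2 : ℤ)}).primesOver (NumberField.RingOfIntegers K)).ncard = 2 →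
  ∀ (κ : ZpExtension K 2), κ.IsAnticyclotomic →
  ∀ (Dt : ModularParametrizationData W (W.conductorNorm ℤ)),
    (∀ z ∈ Dt.L.lattice, ∃ w ∈ periodLattice Dt.f, z = (Dt.c : ℂ) * w) → Odd Dt.c →
  ∀ (β : ℤ) (ι : K →+* ℂ) (jbar : AlgebraicClosure K →+* ℂ),
    (∀ a : K, jbar (algebraMap K (AlgebraicClosure K) a) = ι a) →
  ∀ (d₁ : KolyvaginHeegnerData Dt β ι 1), ¬ IsOfFinAddOrder d₁.derivedPoint →
  ∀ (M₀ : ℕ),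
    (∃ Q : (W.baseChange (ringClassField K ι 1)).toAffine.Point,
        ((2 ^ M₀ : ℕ) : ℤ) • Q = d₁.derivedPoint) →
    (¬ ∃ Q : (W.baseChange (ringClassField K ι 1)).toAffine.Point,
        ((2 ^ (M₀ + 1) : ℕ) : ℤ) • Q = d₁.derivedPoint) →
    1 ≤ M₀ →
  FirstLayerPrimitive W K κ Dt β jbar →
  ∃ (M : ℕ) (s₀ : galH1Torsion W ((2 ^ M : ℕ) : ℤ)),
    s₀ ∈ selmerGroup W ((2 ^ M : ℕ) : ℤ) ∧ ((2 ^ (M₀ - 1) : ℕ) : ℤ) • s₀ ≠ 0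

end Summit.BirchSwinnertonDyer.BirchSwinnertonDyer.Cruxes.GenusDeepSupplyAtTwoNegDiscNarrow.VerticalFirstLayerSupply
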